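import Mathlib
import HarnessLib
import Summits.HubbardSuperconductivity.HubbardSuperconductivity.Theorems.KLProgrammeKLRegimeEngineNormsJumpLastLegCount
import Summits.HubbardSuperconductivity.HubbardSuperconductivity.Theorems.KLProgrammeH10TwoPointLimitKlAnisoLastLegCountUniform

/-!
# Route `KLProgramme` — crux K3 ENGINE (stmt-HubbardSuperconductivity-20437 `KLRegimeEngineV17F2`), stub (b) (ℓ)/(I2): THE RELATIVE JUMP COUNT WITH PRESCRIBED LEGS
# AND ONE DETERMINED LEG — m-UNIFORM FORM (located item «(I2)-CONST-UNIFORM»; cell gate-hubbard-kl, seat p4 g17)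

`card_relCount_prescribed_lastLeg_klAniso_le[_window]` (p4 g11) — the count row read by k3c2-p3's levelled jump rows (`klLevNormOf_jump_le_klEng`,
`…klTowerIncr_remeasure_le_klEng`, the split rows) and by the weighted `_flow_deep/_flow_all` rows — is typed `∀ m, ∃ D, ∀ R, ∃ c₃ U₀, …`: constant and
thresholds are functions of the number of legs.  The kit `towerBorn_le_law_tracks` runs every degree up to the volume-dependent cap, so it needs them
uniform: here the same theorem with the honest quantifier order (same proof, on `card_lastLeg_bgmSectorSet_klAniso_le_frameOK_uniform`): `D₀` and the
thresholds BEFORE `m`, the count CUBIC in `m` times the children count.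

* **`card_relCount_prescribed_lastLeg_klAniso_le_uniform`** — `∃ D₀ > 0, ∀ R (Gfr ≥ 0), ∃ c₃ U₀ > 0, ∀ m, …: # ≤ (D₀ + 1)·(m + 2)³·(27·2^{J′−k})^{(m+1)−|E|−1}`;
* **`card_relCount_prescribed_lastLeg_klAniso_le_window_uniform`** — the same on `klWindowC`.
Everything is PROVED; no definitions, no named facts; nothing about the model is asserted.
References: BGM 2006 §2.8 (2.83), (2.88)–(2.90), App. A3 [cite: BenfattoGiulianiMastropietro2006].
-/

noncomputable section

namespace Summit.HubbardSuperconductivity.HubbardSuperconductivity.Theorems.EngineV8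

set_option linter.dupNamespace false -- summit = problem name (single-conjunct summit), D-0017

open Classical
open Real Finset Literature.MathematicalPhysics.QuantumLattice Literature.Probability.LatticeModels GrassmannAlgebra
open Summit.HubbardSuperconductivity.HubbardSuperconductivity.Theorems.KLProgrammeLegKernels
open Summit.HubbardSuperconductivity.HubbardSuperconductivity.Theorems.KLRegimeSplit
open Summit.HubbardSuperconductivity.HubbardSuperconductivity.Theorems.TorusFourierL2
open Summit.HubbardSuperconductivity.HubbardSuperconductivity.Theorems.PerturbedFermiCurve

/-- **THE RELATIVE JUMP COUNT WITH PRESCRIBED LEGS AND ONE DETERMINED LEG, m-UNIFORM**: for every level window `[μ₁, μ₂] ⊂ (-4, 0)` there is `D₀ > 0`, and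
for every `R` (`Gfr ≥ 0`) thresholds `c₃, U₀ > 0` (all independent of the number of legs), such that for every `m`, all `0 < c ≤ c₃`, `0 < U ≤ U₀`,
`klBetaMin ≤ β ≤ e^{c/U²}`, `μ ∈ [μ₁, μ₂]`, every admissible frame, `L ≥ 1`, `M`, `k ≤ J′`, `A″ ⊆ bgmSectorSet …`, `E`, `τ″`, `σ′`: the number of
`σ″ ∈ A″` agreeing with `τ″` on `E` and overlapping `σ′` leg by leg is `≤ (D₀ + 1)·(m + 2)³·(27·2^{J′−k})^{(m+1) − |E| − 1}`.
[cite: BenfattoGiulianiMastropietro2006, §2.8 (2.83), (2.88)-(2.90), App. A3] -/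
theorem card_relCount_prescribed_lastLeg_klAniso_le_uniform :
    ∀ μ₁ μ₂ : ℝ, -4 < μ₁ → μ₁ ≤ μ₂ → μ₂ < 0 → ∃ D₀ : ℝ, 0 < D₀ ∧ ∀ R : RenConsts, (∀ j, 0 ≤ R.Gfr j) →
      ∃ c₃ : ℝ, 0 < c₃ ∧ ∃ U₀ : ℝ, 0 < U₀ ∧ ∀ m : ℕ,
      ∀ c : ℝ, 0 < c → c ≤ c₃ → ∀ U : ℝ, 0 < U → U ≤ U₀ → ∀ β : ℝ, klBetaMin ≤ β → β ≤ Real.exp (c / U ^ 2) →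
      ∀ μ ∈ Set.Icc μ₁ μ₂, ∀ (ν : ℝ) (K : TrigPolyC4v), FrameOK R U (nScales β) ν K →
      ∀ (L M : ℕ) [NeZero L] (k J' : ℕ), k ≤ J' →
      ∀ A'' : Finset (Fin (m + 1) → SectorLeg (sectorCount J')), A'' ⊆ bgmSectorSet L M (klAnisoFamily L M β μ K klE0 J') (m + 1) →
      ∀ (E : Finset (Fin (m + 1))) (τ'' : Fin (m + 1) → SectorLeg (sectorCount J')) (σ' : Fin (m + 1) → SectorLeg (sectorCount k)),
      (((A''.filter fun σ'' => (∀ e ∈ E, σ'' e = τ'' e) ∧ ∀ i,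
        (∃ q : FreqMomentum L M, klAnisoFamily L M β μ K klE0 J' (σ'' i).1.1 q ≠ 0 ∧
          bgmFatMultiplier L M klE0 β (nambuXiCT L μ K) k (σ' i).1.1 q ≠ 0) ∧
        (σ' i).1.2 = (σ'' i).1.2 ∧ (σ' i).2 = (σ'' i).2).card : ℝ)) ≤
        (D₀ + 1) * ((m : ℝ) + 2) ^ 3 * ((27 * 2 ^ (J' - k) : ℕ) : ℝ) ^ ((m + 1) - E.card - 1) := by
  intro μ₁ μ₂ hμ₁ h12 hμ₂
  obtain ⟨D₀, hD₀, hreg⟩ := card_lastLeg_bgmSectorSet_klAniso_le_frameOK_uniform μ₁ μ₂ hμ₁ h12 hμ₂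
  refine ⟨D₀, hD₀, fun R hR => ?_⟩
  obtain ⟨c₃, hc₃, U₀, hU₀, hcnt⟩ := hreg R hR
  refine ⟨c₃, hc₃, U₀, hU₀, ?_⟩
  intro m c hc hcle U hU hUle β hβmin hβc μ hμ ν K hK L M _ k J' hkJ A'' hA'' E τ'' σ'
  have he : (0 : ℝ) < klE0 := by norm_num [klE0]
  have hlast := hcnt m c hc hcle U hU hUle β hβmin hβc μ hμ ν K hK L M J'
  set D : ℝ := D₀ * ((m : ℝ) + 2) ^ 3 with hDdef
  have hD : 0 < D := by rw [hDdef]; positivity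
  have hX0 : (0 : ℝ) ≤ ((27 * 2 ^ (J' - k) : ℕ) : ℝ) ^ ((m + 1) - E.card - 1) := by positivity
  have hfin : (D + 1) * ((27 * 2 ^ (J' - k) : ℕ) : ℝ) ^ ((m + 1) - E.card - 1) ≤
      (D₀ + 1) * ((m : ℝ) + 2) ^ 3 * ((27 * 2 ^ (J' - k) : ℕ) : ℝ) ^ ((m + 1) - E.card - 1) := by
    refine mul_le_mul_of_nonneg_right ?_ hX0
    have h8 : (1 : ℝ) ≤ ((m : ℝ) + 2) ^ 3 := one_le_pow₀ (by have := Nat.cast_nonneg (α := ℝ) m; linarith)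
    rw [hDdef]; nlinarith only [h8, hD₀]
  refine le_trans ?_ hfin
  have hXpos : (0 : ℝ) < ((27 * 2 ^ (J' - k) : ℕ) : ℝ) ^ ((m + 1) - E.card - 1) := by positivity
  have hX1 : (1 : ℝ) ≤ ((27 * 2 ^ (J' - k) : ℕ) : ℝ) ^ ((m + 1) - E.card - 1) :=
    one_le_pow₀ (by exact_mod_cast Nat.one_le_iff_ne_zero.2 (by positivity))
  by_cases hE : E = Finset.univ
  · -- everything prescribed: at most the one tuple `τ″`
    have h1 : (A''.filter fun σ'' => (∀ e ∈ E, σ'' e = τ'' e) ∧ ∀ i,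
        (∃ q : FreqMomentum L M, klAnisoFamily L M β μ K klE0 J' (σ'' i).1.1 q ≠ 0 ∧
          bgmFatMultiplier L M klE0 β (nambuXiCT L μ K) k (σ' i).1.1 q ≠ 0) ∧
        (σ' i).1.2 = (σ'' i).1.2 ∧ (σ' i).2 = (σ'' i).2).card ≤ 1 := by
      refine Finset.card_le_one.2 fun σ₁ h₁ σ₂ h₂ => ?_
      rw [Finset.mem_filter] at h₁ h₂
      funext e
      rw [h₁.2.1 e (hE ▸ Finset.mem_univ e), h₂.2.1 e (hE ▸ Finset.mem_univ e)]
    have h1r : (((A''.filter fun σ'' => (∀ e ∈ E, σ'' e = τ'' e) ∧ ∀ i,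
        (∃ q : FreqMomentum L M, klAnisoFamily L M β μ K klE0 J' (σ'' i).1.1 q ≠ 0 ∧
          bgmFatMultiplier L M klE0 β (nambuXiCT L μ K) k (σ' i).1.1 q ≠ 0) ∧
        (σ' i).1.2 = (σ'' i).1.2 ∧ (σ' i).2 = (σ'' i).2).card : ℝ)) ≤ 1 := by exact_mod_cast h1
    calc _ ≤ (1 : ℝ) := h1r
      _ ≤ (D + 1) * 1 := by linarith
      _ ≤ (D + 1) * ((27 * 2 ^ (J' - k) : ℕ) : ℝ) ^ ((m + 1) - E.card - 1) :=
          mul_le_mul_of_nonneg_left hX1 (by positivity)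
  · -- a free leg `ℓ ∉ E` is determined by the others
    obtain ⟨ℓ, hℓ⟩ : ∃ ℓ : Fin (m + 1), ℓ ∉ E := by
      by_contra hne
      push Not at hne
      exact hE (Finset.eq_univ_of_forall hne)
    -- children per coarse label (fine side of the thin × fat overlap count, same spin and charge)
    have hκ : ∀ ℓ' : SectorLeg (sectorCount k), ((univ.filter fun ℓ'' : SectorLeg (sectorCount J') =>
        (∃ q : FreqMomentum L M, klAnisoFamily L M β μ K klE0 J' ℓ''.1.1 q ≠ 0 ∧
          bgmFatMultiplier L M klE0 β (nambuXiCT L μ K) k ℓ'.1.1 q ≠ 0) ∧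
        ℓ'.1.2 = ℓ''.1.2 ∧ ℓ'.2 = ℓ''.2).card) ≤ 27 * 2 ^ (J' - k) := by
      intro ℓ'
      calc (univ.filter fun ℓ'' : SectorLeg (sectorCount J') =>
            (∃ q : FreqMomentum L M, klAnisoFamily L M β μ K klE0 J' ℓ''.1.1 q ≠ 0 ∧
              bgmFatMultiplier L M klE0 β (nambuXiCT L μ K) k ℓ'.1.1 q ≠ 0) ∧
            ℓ'.1.2 = ℓ''.1.2 ∧ ℓ'.2 = ℓ''.2).card
          ≤ ((univ : Finset (Fin (sectorCount J'))).filter (fun ω₁ : Fin (sectorCount J') =>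
              ∃ q : FreqMomentum L M, klAnisoFamily L M β μ K klE0 J' ω₁ q ≠ 0 ∧
                bgmFatMultiplier L M klE0 β (nambuXiCT L μ K) k ℓ'.1.1 q ≠ 0)).card := by
            refine Finset.card_le_card_of_injOn (fun ℓ'' : SectorLeg (sectorCount J') => ℓ''.1.1) (fun ℓ'' hℓ'' => ?_)
              (fun ℓ₁ h₁ ℓ₂ h₂ heq => ?_)
            · simp only [mem_coe, mem_filter, mem_univ, true_and] at hℓ'' ⊢
              exact hℓ''.1
            · simp only [mem_coe, mem_filter, mem_univ, true_and] at h₁ h₂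
              exact Prod.ext (Prod.ext heq (h₁.2.1.symm.trans h₂.2.1)) (h₁.2.2.symm.trans h₂.2.2)
        _ ≤ 27 * 2 ^ (J' - k) := card_overlap_klAniso_bgmFat_fine_le he β μ K hkJ _
    -- the last leg: spin and charge from `σ′ ℓ`, sector pinned by the other legs
    have hDceil : ∀ ρ : Fin (m + 1) → SectorLeg (sectorCount J'), ((univ.filter fun s'' : SectorLeg (sectorCount J') =>
        ((∃ q : FreqMomentum L M, klAnisoFamily L M β μ K klE0 J' s''.1.1 q ≠ 0 ∧
          bgmFatMultiplier L M klE0 β (nambuXiCT L μ K) k (σ' ℓ).1.1 q ≠ 0) ∧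
        (σ' ℓ).1.2 = s''.1.2 ∧ (σ' ℓ).2 = s''.2) ∧ Function.update ρ ℓ s'' ∈ A'').card) ≤ ⌈D⌉₊ := by
      intro ρ
      have hinj : ((univ.filter fun s'' : SectorLeg (sectorCount J') =>
          ((∃ q : FreqMomentum L M, klAnisoFamily L M β μ K klE0 J' s''.1.1 q ≠ 0 ∧
            bgmFatMultiplier L M klE0 β (nambuXiCT L μ K) k (σ' ℓ).1.1 q ≠ 0) ∧
          (σ' ℓ).1.2 = s''.1.2 ∧ (σ' ℓ).2 = s''.2) ∧ Function.update ρ ℓ s'' ∈ A'').card) ≤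
          ((Finset.univ : Finset (Fin (sectorCount J'))).filter (fun ω : Fin (sectorCount J') =>
            Function.update ρ ℓ ((ω, (σ' ℓ).1.2), (σ' ℓ).2) ∈ bgmSectorSet L M (klAnisoFamily L M β μ K klE0 J') (m + 1))).card := by
        refine Finset.card_le_card_of_injOn (fun s'' : SectorLeg (sectorCount J') => s''.1.1) (fun s'' hs'' => ?_)
          (fun s₁ h₁ s₂ h₂ heq => ?_)
        · simp only [mem_coe, mem_filter, mem_univ, true_and] at hs'' ⊢
          obtain ⟨⟨-, h2, h3⟩, hA⟩ := hs''
          have hs : s'' = ((s''.1.1, (σ' ℓ).1.2), (σ' ℓ).2) := by rw [h2, h3]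
          rw [← hs]
          exact hA'' hA
        · simp only [mem_coe, mem_filter, mem_univ, true_and] at h₁ h₂
          exact Prod.ext (Prod.ext heq (h₁.1.2.1.symm.trans h₂.1.2.1)) (h₁.1.2.2.symm.trans h₂.1.2.2)
      have hreal : ((((Finset.univ : Finset (Fin (sectorCount J'))).filter (fun ω : Fin (sectorCount J') =>
            Function.update ρ ℓ ((ω, (σ' ℓ).1.2), (σ' ℓ).2) ∈ bgmSectorSet L M (klAnisoFamily L M β μ K klE0 J') (m + 1))).card : ℕ) : ℝ)
            ≤ ⌈D⌉₊ := (hlast ρ ℓ (σ' ℓ).1.2 (σ' ℓ).2).trans (Nat.le_ceil D)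
      exact hinj.trans (by exact_mod_cast hreal)
    have h := card_filter_prescribed_children_lastLeg_le
      (fun (ℓ'' : SectorLeg (sectorCount J')) (ℓ' : SectorLeg (sectorCount k)) =>
        (∃ q : FreqMomentum L M, klAnisoFamily L M β μ K klE0 J' ℓ''.1.1 q ≠ 0 ∧
          bgmFatMultiplier L M klE0 β (nambuXiCT L μ K) k ℓ'.1.1 q ≠ 0) ∧
        ℓ'.1.2 = ℓ''.1.2 ∧ ℓ'.2 = ℓ''.2)
      (fun ℓ' => by convert hκ ℓ' using 2) A'' E τ'' σ' hℓ (D := ⌈D⌉₊) (fun ρ => by convert hDceil ρ using 2)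
    have h' : ((A''.filter fun σ'' => (∀ e ∈ E, σ'' e = τ'' e) ∧ ∀ i,
        (∃ q : FreqMomentum L M, klAnisoFamily L M β μ K klE0 J' (σ'' i).1.1 q ≠ 0 ∧
          bgmFatMultiplier L M klE0 β (nambuXiCT L μ K) k (σ' i).1.1 q ≠ 0) ∧
        (σ' i).1.2 = (σ'' i).1.2 ∧ (σ' i).2 = (σ'' i).2).card) ≤ ⌈D⌉₊ * (27 * 2 ^ (J' - k)) ^ ((m + 1) - E.card - 1) := by
      convert h using 2
    have h'r : (((A''.filter fun σ'' => (∀ e ∈ E, σ'' e = τ'' e) ∧ ∀ i,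
        (∃ q : FreqMomentum L M, klAnisoFamily L M β μ K klE0 J' (σ'' i).1.1 q ≠ 0 ∧
          bgmFatMultiplier L M klE0 β (nambuXiCT L μ K) k (σ' i).1.1 q ≠ 0) ∧
        (σ' i).1.2 = (σ'' i).1.2 ∧ (σ' i).2 = (σ'' i).2).card : ℝ)) ≤
        (⌈D⌉₊ : ℝ) * ((27 * 2 ^ (J' - k) : ℕ) : ℝ) ^ ((m + 1) - E.card - 1) := by exact_mod_cast h'
    have hceil : (⌈D⌉₊ : ℝ) ≤ D + 1 := (Nat.ceil_lt_add_one hD.le).le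
    exact h'r.trans (mul_le_mul_of_nonneg_right hceil hXpos.le)

/-- **The same on the covariance window `klWindowC`, m-uniform.** [cite: BenfattoGiulianiMastropietro2006, §2.8 (2.83), (2.88)-(2.90), App. A3] -/
theorem card_relCount_prescribed_lastLeg_klAniso_le_window_uniform :
    ∃ D₀ : ℝ, 0 < D₀ ∧ ∀ R : RenConsts, (∀ j, 0 ≤ R.Gfr j) →
      ∃ c₃ : ℝ, 0 < c₃ ∧ ∃ U₀ : ℝ, 0 < U₀ ∧ ∀ m : ℕ,
      ∀ c : ℝ, 0 < c → c ≤ c₃ → ∀ U : ℝ, 0 < U → U ≤ U₀ → ∀ β : ℝ, klBetaMin ≤ β → β ≤ Real.exp (c / U ^ 2) →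
      ∀ μ ∈ klWindowC, ∀ (ν : ℝ) (K : TrigPolyC4v), FrameOK R U (nScales β) ν K →
      ∀ (L M : ℕ) [NeZero L] (k J' : ℕ), k ≤ J' →
      ∀ A'' : Finset (Fin (m + 1) → SectorLeg (sectorCount J')), A'' ⊆ bgmSectorSet L M (klAnisoFamily L M β μ K klE0 J') (m + 1) →
      ∀ (E : Finset (Fin (m + 1))) (τ'' : Fin (m + 1) → SectorLeg (sectorCount J')) (σ' : Fin (m + 1) → SectorLeg (sectorCount k)),
      (((A''.filter fun σ'' => (∀ e ∈ E, σ'' e = τ'' e) ∧ ∀ i,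
        (∃ q : FreqMomentum L M, klAnisoFamily L M β μ K klE0 J' (σ'' i).1.1 q ≠ 0 ∧
          bgmFatMultiplier L M klE0 β (nambuXiCT L μ K) k (σ' i).1.1 q ≠ 0) ∧
        (σ' i).1.2 = (σ'' i).1.2 ∧ (σ' i).2 = (σ'' i).2).card : ℝ)) ≤
        (D₀ + 1) * ((m : ℝ) + 2) ^ 3 * ((27 * 2 ^ (J' - k) : ℕ) : ℝ) ^ ((m + 1) - E.card - 1) :=
  card_relCount_prescribed_lastLeg_klAniso_le_uniform (-1.05) (-0.15) (by norm_num) (by norm_num) (by norm_num)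

end Summit.HubbardSuperconductivity.HubbardSuperconductivity.Theorems.EngineV8

end
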